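import Summits.BirchSwinnertonDyer.BirchSwinnertonDyer.Theses.PrintX9
import Summits.BirchSwinnertonDyer.BirchSwinnertonDyer.Theorems.PrintX9HowardContainmentLightFramePinnedOfPrintSharpOfMuStabilized
import Summits.BirchSwinnertonDyer.BirchSwinnertonDyer.Theorems.PrintX9MuPartStabilizedDefs
import HarnessLib

/-!
# Row 9 specialisation of the frame-free μ-residual `MuPartStabilizedOfPrint`: the X9 letter
# `Stmt.muInequalityStabilized` and the deciding crux stmt-BirchSwinnertonDyer-27077 from it

Cell `pub/bsd-print-x9`, seat `bsd-line-x9-p1-w2` (g3); `--supports` stmt-BirchSwinnertonDyer-27077 (helper). HONEST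
FRAMING: two CONDITIONAL theorems; nothing asserted; no item closed; «beyond-print theorem»: no; BSD is NOT proved.

* `muInequalityStabilized_of_muPartStabilizedOfPrint :
    HeegnerMuPartStabilized.MuPartStabilizedOfPrint → PrintX9SharpMuStabilized.Stmt.muInequalityStabilized` — a light X9
  frame supplies the frame-free letter's hypotheses: `CastellaGrossiLeeSkinner2022.Thm413Hypotheses` by
  `X9.thm413Hypotheses_of_lightFrame`; non-CM, `E[p]` irreducible over `ℚ` and the scalar image by the `ClassX9`
  dot-API (`not_hasCM`, `irr`, `hasPadicScalarImage` — Lombardo–Tronto 2022 Thm. 3.16, a tree theorem); `(irr_K)`,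
  `p` split and `p ∣ h_K` are binders.
* `howardContainmentLightFramePinnedOfPrintSharp_of_muPartStabilizedOfPrint :
    HeegnerMuPartStabilized.MuPartStabilizedOfPrint → Theses.PrintX9.HowardContainmentLightFramePinnedOfPrintSharp` —
  composition with the closer `PrintX9SharpMuStabilized.howardContainmentLightFramePinnedOfPrintSharp_of_muStabilized`
  (p624590). So ONE item lettered `MuPartStabilizedOfPrint` (route-independent module
  `Theorems/PrintX9MuPartStabilizedDefs`) closes row 9's deciding crux by this glue (and row 10's by its twin).
-/

set_option linter.dupNamespace false
set_option autoImplicit false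

noncomputable section

open scoped Classical
open Literature Literature.NumberTheory.EllipticCurves WeierstrassCurve
  Literature.NumberTheory.EllipticCurves.ModularForms
open Summit.BirchSwinnertonDyer.BirchSwinnertonDyer.Theses.PrintX9
open Summit.BirchSwinnertonDyer.BirchSwinnertonDyer.Theorems.HeegnerMuPartStabilized (MuPartStabilizedOfPrint)

namespace Summit.BirchSwinnertonDyer.BirchSwinnertonDyer.Theorems.PrintX9SharpMuStabilized

/-- **Frame-free ⟹ row-9 letter**: the stabilised μ-inequality on light X9 frames at `p ∣ h_K`
(`Stmt.muInequalityStabilized`) from `MuPartStabilizedOfPrint` — the X9 frame discharges the print hypotheses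
(`X9.thm413Hypotheses_of_lightFrame`; `ClassX9`: non-CM, `(irr)`, scalars `1 + pℤ_p` by Lombardo–Tronto 2022
Thm. 3.16). [cite: LombardoTronto2022, Thm. 3.16] [cite: MastellaZerman2026, Assumptions 2.1 and 2.13]
[cite: CastellaGrossiLeeSkinner2022, §3.2 standing hypotheses of Thm. 4.1.3] -/
theorem muInequalityStabilized_of_muPartStabilizedOfPrint (h : MuPartStabilizedOfPrint) :
    Stmt.muInequalityStabilized := by
  intro W _ _ p _ _ K _ _ hX9 hK hodd h3 hHN hHp hirr κ hκ γ hγ jbar hhK D C X hfinS hfinX htorC 𝔭 h𝔭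
  have hX9' := Summit.BirchSwinnertonDyer.BirchSwinnertonDyer.Rank1Residual.classX9_census_of_classX9 W p hX9
  have hyp := Summit.BirchSwinnertonDyer.Rank1Residual.X9.thm413Hypotheses_of_lightFrame hX9' hK hodd h3 hHN hHp
    hκ hγ
  exact h (W.conductorNorm ℤ) W K p κ γ jbar hyp hX9'.not_hasCM hX9'.irr hirr hX9'.hasPadicScalarImage hHp hhK
    D C X hfinS hfinX htorC 𝔭 h𝔭

/-- **The deciding crux of row 9 from the frame-free μ-residual** (BY NAME on the route decl): composition of
`muInequalityStabilized_of_muPartStabilizedOfPrint` with the closer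
`howardContainmentLightFramePinnedOfPrintSharp_of_muStabilized` (p624590). CONDITIONAL; credits nothing by itself.
[cite: MastellaZerman2026, Cor. 4.6] [cite: CastellaGrossiLeeSkinner2022, Thm. 4.1.1] [cite: CastellaGrossiSkinner2025, Thm. 6.5.2] -/
theorem howardContainmentLightFramePinnedOfPrintSharp_of_muPartStabilizedOfPrint (h : MuPartStabilizedOfPrint) :
    Summit.BirchSwinnertonDyer.BirchSwinnertonDyer.Theses.PrintX9.HowardContainmentLightFramePinnedOfPrintSharp :=
  howardContainmentLightFramePinnedOfPrintSharp_of_muStabilized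
    (muInequalityStabilized_of_muPartStabilizedOfPrint h)

end Summit.BirchSwinnertonDyer.BirchSwinnertonDyer.Theorems.PrintX9SharpMuStabilized

end
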